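import Literature.NumberTheory.Automorphic.ArchRankinSelbergKAverageGL2
import Literature.NumberTheory.Automorphic.ArchUnipotentSmoothingGL2
import HarnessLib

/-!
# Plumbing for the `K_∞`-average identity of the archimedean `GL₂ × GL₂` Rankin–Selberg integral:
# averaging translates over `K₁`, continuity of `k ↦ W_{τ(k)e}(t)`, the subgroup `K₁ = {diag(u,1)} ∩ K_∞`
# (Humphries–Jo (2024), §5, proof of Prop. 5.2)

Topic `NumberTheory/Automorphic`; namespace `Literature.NumberTheory.Automorphic`. Theorems only (no
definition, no named fact, no instance). Three generic inputs of the assembly of the `K_∞`-average Gamma identity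
(`HumphriesJo2024_archRankinSelberg_testVector_two_gammaIdentity_of_kAverage`) from the reproducing kernel:

* `integrable_integral_comp_mul_and_eq` — for an invariant measure `μ` on a commutative group `X`, a finite measure
  `μ₁` on `T`, `c : T → X` measurable and `F ∈ L¹(μ)` measurable: `∫_X ∫_T F(y · c(k)) dμ₁ dμ = μ₁(T) ∫_X F dμ`
  (Fubini and invariance) — once the reproducing kernel has turned the `K_∞`-average into the `K₁`-average
  `∫_{K₁} W_e(tζ) conj W'_{e'}(tζ) dμ₁(ζ)`, this removes the `K₁`-average from the Mellin transform over `K_∞ˣ`;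
* `continuous_kirillovFn_gardingAct(_Kinf)` — `g ↦ W_{τ(g)e}(t) = ℓ(τ(diag(t,1) g) e)` is continuous on `GL₂(K_∞)`
  (Sobolev bound of the Whittaker functional, `continuous_apply_toArch_functional`), so the integrand of the
  `K_∞`-average is a continuous function on the compact group `K_∞`, as the reproducing kernel requires;
* `exists_kOneSubgroup` — the subgroup `K₁ = {k ∈ K_∞ : k = diag(u,1)}` of `K_∞` (the stabiliser of `e₂`) exists
  and is closed (`{g₀₁ = g₁₀ = 0, g₁₁ = 1}`; `eq_diagGL2_det_one_of_entries`), and `diag(u,1) ∈ K_∞` forces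
  `|u_w| = 1` at every place and `N(u) = 1` (`normAtPlace_eq_one_of_diagGL2_mem_Kinf`).

## References

* P. Humphries, Y. Jo, *Test vectors for archimedean period integrals*, Publ. Mat. 68 (2024), §5,
  proof of Prop. 5.2 [HumphriesJo2024].
-/

noncomputable section

open MeasureTheory Measure NumberField NumberField.mixedEmbedding NumberField.InfinitePlace IsDedekindDomain Set Filter
open scoped MatrixGroups ENNReal NNReal Classical ComplexConjugate

namespace Literature.NumberTheory.Automorphic

/-! ### 1. Averaging a translate over a finite measure against an invariant measure -/

section Average

/-- **Averaging translates eliminates the average**: for an invariant measure `μ` on a commutative group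
`X`, a finite measure `μ₁` on `T`, a measurable `c : T → X` and `F ∈ L¹(μ)` measurable,
`y ↦ ∫_T F(y · c(k)) dμ₁(k)` is `μ`-integrable and `∫_X ∫_T F(y · c(k)) dμ₁ dμ = μ₁(T) · ∫_X F dμ` (Fubini and the
invariance of `μ` under `y ↦ y · c(k)`). The device removing the `K₁`-average `∫_{K₁} W_e(tζ) conj W'_{e'}(tζ) dζ`
from the Mellin transform over `K_∞ˣ` in the Humphries–Jo computation. [folklore] -/
theorem integrable_integral_comp_mul_and_eq {X : Type*} [CommGroup X] [TopologicalSpace X] [IsTopologicalGroup X]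
    [MeasurableSpace X] [BorelSpace X] [SecondCountableTopology X]
    (μ : Measure X) [SFinite μ] [μ.IsMulLeftInvariant]
    {T : Type*} [MeasurableSpace T] (μ₁ : Measure T) [IsFiniteMeasure μ₁]
    {c : T → X} (hc : Measurable c) {F : X → ℂ} (hFm : Measurable F) (hF : Integrable F μ) :
    Integrable (fun y => ∫ k, F (y * c k) ∂μ₁) μ ∧
    ∫ y, (∫ k, F (y * c k) ∂μ₁) ∂μ = μ₁.real univ * ∫ y, F y ∂μ := by
  set Φ : T × X → ℂ := fun p => F (p.2 * c p.1) with hΦ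
  have hΦm : Measurable Φ := hFm.comp (measurable_snd.mul (hc.comp measurable_fst))
  have hΦint : Integrable Φ (μ₁.prod μ) := by
    refine (integrable_prod_iff hΦm.aestronglyMeasurable).2 ⟨Eventually.of_forall fun k => hF.comp_mul_right (c k), ?_⟩
    have hconst : (fun k : T => ∫ y, ‖Φ (k, y)‖ ∂μ) = fun _ => ∫ y, ‖F y‖ ∂μ := by
      funext k
      exact integral_mul_right_eq_self (fun y => ‖F y‖) (c k)
    rw [hconst]
    exact integrable_const _
  refine ⟨hΦint.integral_prod_right, ?_⟩
  have hswap := integral_integral_swap (f := fun (k : T) (y : X) => Φ (k, y)) hΦint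
  -- `∫_T ∫_X Φ = ∫_X ∫_T Φ`
  calc ∫ y, (∫ k, F (y * c k) ∂μ₁) ∂μ = ∫ y, (∫ k, Φ (k, y) ∂μ₁) ∂μ := rfl
    _ = ∫ k, (∫ y, Φ (k, y) ∂μ) ∂μ₁ := hswap.symm
    _ = ∫ k, (∫ y, F y ∂μ) ∂μ₁ := by
        refine integral_congr_ae (Eventually.of_forall fun k => ?_)
        exact integral_mul_right_eq_self F (c k)
    _ = μ₁.real univ * ∫ y, F y ∂μ := by
        rw [integral_const, Complex.real_smul]

end Average

/-! ### 2. Continuity of `k ↦ W_{τ(k)e}(t)` on `GL₂(K_∞)` -/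

section Continuity

-- as in `ArchGardingWhittaker`
set_option backward.isDefEq.respectTransparency false

variable {K : Type} [Field K] [NumberField K] {hcpt : isCompact_glFiniteIntegralLevel 2 K}
  {E : Type*} [NormedAddCommGroup E] [InnerProductSpace ℂ E] [CompleteSpace E]
  {τ : ContRepresentation ℂ (AutomorphyDatum.gl 2 K hcpt).arch.carrier E}

/-- **`g ↦ W_{τ(g)e}(t)` is continuous on `GL₂(K_∞)`** for a continuous Whittaker functional (Sobolev bound
`hℓW.norm_le`) and a Gårding vector `e`: `W_{τ(g)e}(t) = ℓ(τ(diag(t,1) g) e)` and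
`continuous_apply_toArch_functional`. [folklore] -/
theorem continuous_kirillovFn_gardingAct (hτ : τ.IsStronglyContinuous) {ℓ : archGardingSpace hcpt τ →ₗ[ℂ] ℂ}
    (hℓW : IsArchContWhittakerFunctional hcpt τ hτ ℓ) (e : archGardingSpace hcpt τ) (t : (mixedSpace K)ˣ) :
    Continuous fun g : GL (Fin 2) (mixedSpace K) => kirillovFn hτ ℓ (gardingAct hτ g e) t := by
  have h := continuous_apply_toArch_functional hτ hℓW.norm_le e.2 (γ := fun g : GL (Fin 2) (mixedSpace K) => diagGL2 t 1 * g)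
    (continuous_const.mul continuous_id)
  refine h.congr fun g => ?_
  rw [kirillovFn_eq_apply_gardingAct, ← Module.End.mul_apply, ← gardingAct_mul]
  rfl

/-- **`k ↦ W_{τ(k)e}(t)` is continuous on `K_∞`.** [folklore] -/
theorem continuous_kirillovFn_gardingAct_Kinf (hτ : τ.IsStronglyContinuous) {ℓ : archGardingSpace hcpt τ →ₗ[ℂ] ℂ}
    (hℓW : IsArchContWhittakerFunctional hcpt τ hτ ℓ) (e : archGardingSpace hcpt τ) (t : (mixedSpace K)ˣ) :
    Continuous fun k : ↥(Kinf 2 K) => kirillovFn hτ ℓ (gardingAct hτ ((k : ↥(Kinf 2 K)) : GL (Fin 2) (mixedSpace K)) e) t :=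
  (continuous_kirillovFn_gardingAct hτ hℓW e t).comp continuous_subtype_val

end Continuity

/-! ### 3. The subgroup `K₁ = {diag(u, 1)} ∩ K_∞` of `K_∞` -/

section KOne

-- as in `ArchGardingWhittaker`
set_option backward.isDefEq.respectTransparency false

variable (K : Type) [Field K] [NumberField K]

omit [NumberField K] in
/-- A matrix `g ∈ GL₂(K_∞)` with `g₀₁ = g₁₀ = 0`, `g₁₁ = 1` is `diag(det g, 1)`. [folklore] -/
theorem eq_diagGL2_det_one_of_entries {g : GL (Fin 2) (mixedSpace K)}
    (h01 : (g : Matrix (Fin 2) (Fin 2) (mixedSpace K)) 0 1 = 0) (h10 : (g : Matrix (Fin 2) (Fin 2) (mixedSpace K)) 1 0 = 0)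
    (h11 : (g : Matrix (Fin 2) (Fin 2) (mixedSpace K)) 1 1 = 1) :
    g = diagGL2 (Matrix.GeneralLinearGroup.det g) 1 := by
  have hdet : ((Matrix.GeneralLinearGroup.det g : (mixedSpace K)ˣ) : mixedSpace K) = (g : Matrix (Fin 2) (Fin 2) (mixedSpace K)) 0 0 := by
    rw [Matrix.GeneralLinearGroup.val_det_apply, Matrix.det_fin_two, h01, h11, mul_one, zero_mul, sub_zero]
  refine Units.ext (Matrix.ext fun i j => ?_)
  rw [coe_diagGL2]
  fin_cases i <;> fin_cases j
  · simp [hdet]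
  · simp [h01]
  · simp [h10]
  · simp [h11]

/-- **The subgroup `K₁ = {diag(u,1)} ∩ K_∞` of `K_∞` exists and is closed** (the common stabiliser of `e₂` in
`K_∞`; `K₁ ≅ ∏_{w real} {±1} × ∏_{w complex} U(1)`). [folklore] -/
theorem exists_kOneSubgroup :
    ∃ K₁ : Subgroup ↥(Kinf 2 K),
      (∀ k : ↥(Kinf 2 K), k ∈ K₁ ↔ ∃ u : (mixedSpace K)ˣ, ((k : ↥(Kinf 2 K)) : GL (Fin 2) (mixedSpace K)) = diagGL2 u 1) ∧
      IsClosed (K₁ : Set ↥(Kinf 2 K)) := by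
  -- the torus `{diag(u,1)}` as a subgroup of `GL₂(K_∞)`
  let T : Subgroup (GL (Fin 2) (mixedSpace K)) :=
    { carrier := {g | ∃ u : (mixedSpace K)ˣ, g = diagGL2 u 1}
      one_mem' := ⟨1, Units.ext (by rw [coe_diagGL2_one, Units.val_one, Units.val_one, sub_self, Matrix.single_zero, add_zero])⟩
      mul_mem' := by
        rintro _ _ ⟨u, rfl⟩ ⟨u', rfl⟩
        exact ⟨u * u', (diagGL2_one_mul u u').symm⟩
      inv_mem' := by
        rintro _ ⟨u, rfl⟩
        exact ⟨u⁻¹, diagGL2_one_inv u⟩ }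
  refine ⟨T.comap (Kinf 2 K).subtype, fun k => Iff.rfl, ?_⟩
  -- closedness: `T = {g₀₁ = 0, g₁₀ = 0, g₁₁ = 1}`
  have hT : (T : Set (GL (Fin 2) (mixedSpace K))) = {g : GL (Fin 2) (mixedSpace K) | (g : Matrix (Fin 2) (Fin 2) (mixedSpace K)) 0 1 = 0 ∧
      (g : Matrix (Fin 2) (Fin 2) (mixedSpace K)) 1 0 = 0 ∧ (g : Matrix (Fin 2) (Fin 2) (mixedSpace K)) 1 1 = 1} := by
    ext g
    constructor
    · rintro ⟨u, rfl⟩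
      simp [coe_diagGL2]
    · rintro ⟨h01, h10, h11⟩
      exact ⟨_, eq_diagGL2_det_one_of_entries K h01 h10 h11⟩
  have hTc : IsClosed (T : Set (GL (Fin 2) (mixedSpace K))) := by
    rw [hT]
    have hc : ∀ i j : Fin 2, Continuous fun g : GL (Fin 2) (mixedSpace K) => (g : Matrix (Fin 2) (Fin 2) (mixedSpace K)) i j :=
      fun i j => Units.continuous_val.matrix_elem i j
    exact ((isClosed_eq (hc 0 1) continuous_const).inter ((isClosed_eq (hc 1 0) continuous_const).inter
      (isClosed_eq (hc 1 1) continuous_const)))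
  exact hTc.preimage continuous_subtype_val

/-- **`diag(u,1) ∈ K_∞` forces `|u_w| = 1` at every place** (`star u · u = 1`): the unit norm at each place and
`N(u) = 1`. [folklore] -/
theorem normAtPlace_eq_one_of_diagGL2_mem_Kinf {u : (mixedSpace K)ˣ} (hu : (diagGL2 u 1 : GL (Fin 2) (mixedSpace K)) ∈ Kinf 2 K) :
    (∀ w : {w : InfinitePlace K // IsReal w}, |((u : (mixedSpace K)ˣ) : mixedSpace K).1 w| = 1) ∧
    (∀ w : {w : InfinitePlace K // IsComplex w}, ‖((u : (mixedSpace K)ˣ) : mixedSpace K).2 w‖ = 1) ∧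
    mixedEmbedding.norm ((u : (mixedSpace K)ˣ) : mixedSpace K) = 1 := by
  rw [Kinf_eq_unitarySubgroupGL, mem_unitarySubgroupGL_iff, coe_diagGL2] at hu
  have h00 := congrArg (fun M : Matrix (Fin 2) (Fin 2) (mixedSpace K) => M 0 0) hu
  simp only [Matrix.star_eq_conjTranspose, Matrix.mul_apply, Fin.sum_univ_two, Matrix.conjTranspose_apply, Matrix.of_apply,
    Matrix.cons_val', Matrix.cons_val_zero, Matrix.cons_val_one, Matrix.empty_val', Matrix.cons_val_fin_one,
    Matrix.one_apply_eq, star_zero, mul_zero, add_zero] at h00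
  -- `h00 : star u * u = 1` in `K_∞`
  have hR : ∀ w : {w : InfinitePlace K // IsReal w}, |((u : (mixedSpace K)ˣ) : mixedSpace K).1 w| = 1 := fun w => by
    have h := congrArg (fun x : mixedSpace K => x.1 w) h00
    simp only [Prod.fst_mul, Pi.mul_apply, Prod.fst_star, star_trivial, Prod.fst_one, Pi.one_apply] at h
    have h' : |((u : (mixedSpace K)ˣ) : mixedSpace K).1 w| ^ 2 = 1 := by rw [sq_abs, sq]; exact h
    nlinarith [abs_nonneg (((u : (mixedSpace K)ˣ) : mixedSpace K).1 w)]
  have hC : ∀ w : {w : InfinitePlace K // IsComplex w}, ‖((u : (mixedSpace K)ˣ) : mixedSpace K).2 w‖ = 1 := fun w => by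
    have h := congrArg (fun x : mixedSpace K => x.2 w) h00
    simp only [Prod.snd_mul, Pi.mul_apply, Prod.snd_star, Pi.star_apply, Prod.snd_one, Pi.one_apply,
      Complex.star_def] at h
    have h' : ‖((u : (mixedSpace K)ˣ) : mixedSpace K).2 w‖ ^ 2 = 1 := by
      have h2 : ((Complex.normSq (((u : (mixedSpace K)ˣ) : mixedSpace K).2 w) : ℝ) : ℂ) = 1 := by
        rw [Complex.normSq_eq_conj_mul_self]; exact h
      rw [← Complex.normSq_eq_norm_sq]
      exact_mod_cast h2
    nlinarith [norm_nonneg (((u : (mixedSpace K)ˣ) : mixedSpace K).2 w)]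
  refine ⟨hR, hC, ?_⟩
  rw [mixedEmbedding.norm_apply]
  refine Finset.prod_eq_one fun w _ => ?_
  obtain hw | hw := isReal_or_isComplex w
  · rw [normAtPlace_apply_of_isReal hw, Real.norm_eq_abs, hR ⟨w, hw⟩, one_pow]
  · rw [normAtPlace_apply_of_isComplex hw, hC ⟨w, hw⟩, one_pow]

end KOne

end Literature.NumberTheory.Automorphic
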